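import Summits.KontsevichZagierPeriods.KontsevichZagierPeriods.Theorems.LinRedNormalFormArrangementNormalFormStubRebaseSimpleZeroNestedDiffE1VertexTools
import Summits.KontsevichZagierPeriods.KontsevichZagierPeriods.Theorems.LinRedNormalFormArrangementNormalFormStubRebaseSimpleZeroNestedDiffCells
import Summits.KontsevichZagierPeriods.KontsevichZagierPeriods.Theorems.LinRedNormalFormArrangementNormalFormStubRebaseSimpleZeroProductBlow

/-!
# Stub `stub_rebaseSimpleZeroTwo`, part `rebaseSimpleZero_HDiff1_of_HPar1` (crux
`ArrangementNormalForm`, line `janus-bands`) — brick `NestedDiffE1VertexBlow`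

**A pinch vertex carrying BOTH letters: the vertex dilation.** For a datum of the interval normal
form `HDiff₁` (`RebaseE1.IsDN`: clean nest `A(y) < tᵢ < tⱼ < B(y)` over `{l < y < u}`, inner
letter `cᵢ` constant, outer letter `cⱼ` of slope `λ`) pinching at the left end,
`A(l) = B(l) = t₀`, with BOTH letters through the vertex (`cᵢ = t₀`, `cⱼ(l) = t₀`), every box of
a sub- or super-section Janus has a letter face; instead ONE rational change of variables
(rule 2), the VERTEX DILATION `tₖ = t₀ + (y − l) sₖ` of both fibres (`RebaseE1.vdil`, Jacobian
`(y − l)²`), turns the nest into the clean nest `A' < sᵢ < sⱼ < B'` with CONSTANT bounds over the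
same interval and the literal integrand `K/((y − r)(tᵢ − t₀)(tⱼ − cⱼ(y)))` into
`K/((y − r) sᵢ (sⱼ − λ))` — constant letters `0, λ`: a common-slope datum, good by the landed
`RebaseDiff.good_any` (`RebaseE1.IsDN.good_vtx_both`, registered as `rebaseSimpleZero_E1vertexBoth`;
no hypothesis on the base pole is needed). Calculus of the one-fibre dilation `RebaseE1.dil`
(rank-one perturbation of the identity, `det = y − l`, inverse `RebaseE1.undil`).

References: M. Kontsevich, D. Zagier, *Periods* (2001), §1.2, rule (2).
-/

noncomputable section

open Set MeasureTheory MvPolynomial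
open Literature.NumberTheory.Transcendental Literature.ModelTheory.ExponentialFields

namespace Summit.KontsevichZagierPeriods.ArrangementNormalForm.JanusBands

namespace RebaseE1

open SeparatePos RebasePos RebaseZero RebaseNest RebaseDiff

variable {i j : Fin 2} {s : KZ.IntegralRep (0 + 1 + 2)} {l u : ℚ} {A B : Cf} {T : BData}
  {p : MvPolynomial (Fin 0) ℚ} {a : Fin 2 → Option Cf} {ci cj : Cf}

/-! ### The one-fibre dilation -/

/-- The dilation of the fibre `k` from the vertex `(l, t₀)`: `tₖ ↦ t₀ + (y − l) tₖ`. -/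
def dil (k : Fin 2) (l t₀ : ℚ) (w : Fin (0 + 1 + 2) → ℝ) : Fin (0 + 1 + 2) → ℝ :=
  Function.update w (tIdx k) ((t₀ : ℝ) + (w (yIdx 2) - l) * w (tIdx k))

/-- Its inverse off `y = l`: `tₖ ↦ (tₖ − t₀)/(y − l)`. -/
def undil (k : Fin 2) (l t₀ : ℚ) (z : Fin (0 + 1 + 2) → ℝ) : Fin (0 + 1 + 2) → ℝ :=
  Function.update z (tIdx k) ((z (tIdx k) - t₀) / (z (yIdx 2) - l))

/-- `dil` fixes the base. -/
@[simp] theorem yv_dil (k : Fin 2) (l t₀ : ℚ) (w : Fin (0 + 1 + 2) → ℝ) : yv (dil k l t₀ w) = yv w := by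
  simp [dil, yv, Function.update_of_ne (yIdx_ne_tIdx k)]

/-- `dil` on its fibre. -/
@[simp] theorem tv_dil_self (k : Fin 2) (l t₀ : ℚ) (w : Fin (0 + 1 + 2) → ℝ) :
    tv (dil k l t₀ w) k = t₀ + (yv w - l) * tv w k := by
  simp [dil, tv, yv]

/-- `dil` fixes the other fibre. -/
theorem tv_dil_ne {k k' : Fin 2} (h : k' ≠ k) (l t₀ : ℚ) (w : Fin (0 + 1 + 2) → ℝ) :
    tv (dil k l t₀ w) k' = tv w k' := by
  simp [dil, tv, Function.update_of_ne (tIdx_injective.ne h)]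

/-- `undil` fixes the base. -/
@[simp] theorem yv_undil (k : Fin 2) (l t₀ : ℚ) (z : Fin (0 + 1 + 2) → ℝ) : yv (undil k l t₀ z) = yv z := by
  simp [undil, yv, Function.update_of_ne (yIdx_ne_tIdx k)]

/-- `undil` on its fibre. -/
@[simp] theorem tv_undil_self (k : Fin 2) (l t₀ : ℚ) (z : Fin (0 + 1 + 2) → ℝ) :
    tv (undil k l t₀ z) k = (tv z k - t₀) / (yv z - l) := by
  simp [undil, tv, yv]

/-- `undil` fixes the other fibre. -/
theorem tv_undil_ne {k k' : Fin 2} (h : k' ≠ k) (l t₀ : ℚ) (z : Fin (0 + 1 + 2) → ℝ) :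
    tv (undil k l t₀ z) k' = tv z k' := by
  simp [undil, tv, Function.update_of_ne (tIdx_injective.ne h)]

/-- `undil ∘ dil = id` off `y = l`. -/
theorem undil_dil (k : Fin 2) (l t₀ : ℚ) {w : Fin (0 + 1 + 2) → ℝ} (hy : yv w ≠ l) :
    undil k l t₀ (dil k l t₀ w) = w := by
  have hy' : w (yIdx 2) - (l : ℝ) ≠ 0 := sub_ne_zero.2 hy
  funext q
  by_cases hq : q = tIdx k
  · subst hq
    simp only [undil, dil, Function.update_self, Function.update_of_ne (yIdx_ne_tIdx k)]
    field_simp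
    ring
  · simp only [undil, dil, Function.update_of_ne hq]

/-- `dil ∘ undil = id` off `y = l`. -/
theorem dil_undil (k : Fin 2) (l t₀ : ℚ) {z : Fin (0 + 1 + 2) → ℝ} (hy : yv z ≠ l) :
    dil k l t₀ (undil k l t₀ z) = z := by
  have hy' : z (yIdx 2) - (l : ℝ) ≠ 0 := sub_ne_zero.2 hy
  funext q
  by_cases hq : q = tIdx k
  · subst hq
    simp only [undil, dil, Function.update_self, Function.update_of_ne (yIdx_ne_tIdx k)]
    field_simp
    ring
  · simp only [undil, dil, Function.update_of_ne hq]

/-- `dil` is injective off `y = l`. -/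
theorem dil_injOn (k : Fin 2) (l t₀ : ℚ) {Q : Set (Fin (0 + 1 + 2) → ℝ)} (hQ : ∀ w ∈ Q, yv w ≠ l) :
    InjOn (dil k l t₀) Q := fun w hw w' hw' h => by
  rw [← undil_dil k l t₀ (hQ w hw), h, undil_dil k l t₀ (hQ w' hw')]

/-- `dil` as a rank-one perturbation of the identity. -/
theorem dil_eq (k : Fin 2) (l t₀ : ℚ) (w : Fin (0 + 1 + 2) → ℝ) :
    dil k l t₀ w = w + ((t₀ : ℝ) + (w (yIdx 2) - l) * w (tIdx k) - w (tIdx k)) •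
      (Pi.single (tIdx k) (1 : ℝ) : Fin (0 + 1 + 2) → ℝ) := by
  funext q
  by_cases hq : q = tIdx k
  · subst hq
    simp [dil]
  · simp [dil, Function.update_of_ne hq, Pi.single_eq_of_ne hq]

/-- The derivative of `dil` at `w`. -/
def dilL (k : Fin 2) (l : ℚ) (w : Fin (0 + 1 + 2) → ℝ) : (Fin (0 + 1 + 2) → ℝ) →L[ℝ] (Fin (0 + 1 + 2) → ℝ) :=
  ContinuousLinearMap.id ℝ _ + ContinuousLinearMap.smulRight
    ((w (yIdx 2) - (l : ℝ)) • ContinuousLinearMap.proj (R := ℝ) (φ := fun _ : Fin (0 + 1 + 2) => ℝ) (tIdx k) +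
      w (tIdx k) • ContinuousLinearMap.proj (R := ℝ) (φ := fun _ : Fin (0 + 1 + 2) => ℝ) (yIdx 2) -
      ContinuousLinearMap.proj (R := ℝ) (φ := fun _ : Fin (0 + 1 + 2) => ℝ) (tIdx k))
    (Pi.single (tIdx k) (1 : ℝ) : Fin (0 + 1 + 2) → ℝ)

/-- `dil` has the derivative `dilL`. -/
theorem hasFDerivAt_dil (k : Fin 2) (l t₀ : ℚ) (w : Fin (0 + 1 + 2) → ℝ) :
    HasFDerivAt (dil k l t₀) (dilL k l w) w := by
  have h1 : HasFDerivAt (fun z : Fin (0 + 1 + 2) → ℝ => z (yIdx 2))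
      (ContinuousLinearMap.proj (R := ℝ) (φ := fun _ : Fin (0 + 1 + 2) => ℝ) (yIdx 2)) w :=
    hasFDerivAt_apply (yIdx 2) w
  have h2 : HasFDerivAt (fun z : Fin (0 + 1 + 2) → ℝ => z (tIdx k))
      (ContinuousLinearMap.proj (R := ℝ) (φ := fun _ : Fin (0 + 1 + 2) => ℝ) (tIdx k)) w :=
    hasFDerivAt_apply (tIdx k) w
  have hφ := (((((h1.sub_const (l : ℝ)).mul h2).const_add (t₀ : ℝ)).sub h2).smul_const
    (Pi.single (tIdx k) (1 : ℝ) : Fin (0 + 1 + 2) → ℝ))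
  have e : dil k l t₀ = fun z => z + ((t₀ : ℝ) + (z (yIdx 2) - l) * z (tIdx k) - z (tIdx k)) •
      (Pi.single (tIdx k) (1 : ℝ) : Fin (0 + 1 + 2) → ℝ) := funext (dil_eq k l t₀)
  rw [e]
  exact (hasFDerivAt_id w).add hφ

/-- The Jacobian of `dil` is `y − l`. -/
theorem det_dilL (k : Fin 2) (l : ℚ) (w : Fin (0 + 1 + 2) → ℝ) : (dilL k l w).det = yv w - l := by
  rw [dilL, det_id_add_smulRight]
  simp [yv, yIdx_ne_tIdx k]

/-! ### The vertex dilation of both fibres -/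

/-- The vertex dilation of both fibres. -/
def vdil (i j : Fin 2) (l t₀ : ℚ) (w : Fin (0 + 1 + 2) → ℝ) : Fin (0 + 1 + 2) → ℝ :=
  dil j l t₀ (dil i l t₀ w)

/-- Its inverse off `y = l`. -/
def vundil (i j : Fin 2) (l t₀ : ℚ) (z : Fin (0 + 1 + 2) → ℝ) : Fin (0 + 1 + 2) → ℝ :=
  undil i l t₀ (undil j l t₀ z)

/-- `vdil` fixes the base. -/
@[simp] theorem yv_vdil (l t₀ : ℚ) (w : Fin (0 + 1 + 2) → ℝ) : yv (vdil i j l t₀ w) = yv w := by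
  simp [vdil]

/-- `vdil` on the inner fibre. -/
theorem tv_vdil_i (hij : i ≠ j) (l t₀ : ℚ) (w : Fin (0 + 1 + 2) → ℝ) :
    tv (vdil i j l t₀ w) i = t₀ + (yv w - l) * tv w i := by
  rw [vdil, tv_dil_ne hij, tv_dil_self]

/-- `vdil` on the outer fibre. -/
theorem tv_vdil_j (hij : i ≠ j) (l t₀ : ℚ) (w : Fin (0 + 1 + 2) → ℝ) :
    tv (vdil i j l t₀ w) j = t₀ + (yv w - l) * tv w j := by
  rw [vdil, tv_dil_self, yv_dil, tv_dil_ne hij.symm]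

/-- `vundil` fixes the base. -/
@[simp] theorem yv_vundil (l t₀ : ℚ) (z : Fin (0 + 1 + 2) → ℝ) : yv (vundil i j l t₀ z) = yv z := by
  simp [vundil]

/-- `vundil` on the inner fibre. -/
theorem tv_vundil_i (hij : i ≠ j) (l t₀ : ℚ) (z : Fin (0 + 1 + 2) → ℝ) :
    tv (vundil i j l t₀ z) i = (tv z i - t₀) / (yv z - l) := by
  rw [vundil, tv_undil_self, yv_undil, tv_undil_ne hij]

/-- `vundil` on the outer fibre. -/
theorem tv_vundil_j (hij : i ≠ j) (l t₀ : ℚ) (z : Fin (0 + 1 + 2) → ℝ) :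
    tv (vundil i j l t₀ z) j = (tv z j - t₀) / (yv z - l) := by
  rw [vundil, tv_undil_ne hij.symm, tv_undil_self]

/-- `vdil ∘ vundil = id` off `y = l`. -/
theorem vdil_vundil (l t₀ : ℚ) {z : Fin (0 + 1 + 2) → ℝ} (hy : yv z ≠ l) :
    vdil i j l t₀ (vundil i j l t₀ z) = z := by
  have hy' : yv (undil j l t₀ z) ≠ l := by rwa [yv_undil]
  rw [vdil, vundil, dil_undil i l t₀ hy', dil_undil j l t₀ hy]

/-- `vdil` is injective off `y = l`. -/
theorem vdil_injOn (l t₀ : ℚ) {Q : Set (Fin (0 + 1 + 2) → ℝ)} (hQ : ∀ w ∈ Q, yv w ≠ l) :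
    InjOn (vdil i j l t₀) Q := by
  have h1 : InjOn (dil i l t₀) Q := dil_injOn i l t₀ hQ
  have h2 : InjOn (dil j l t₀) {w | yv w ≠ l} := dil_injOn j l t₀ fun w hw => hw
  have hm : MapsTo (dil i l t₀) Q {w | yv w ≠ l} := fun w hw => by
    show yv (dil i l t₀ w) ≠ l
    rw [yv_dil]; exact hQ w hw
  exact h2.comp h1 hm

/-- `vdil` in coordinates: a polynomial map. -/
theorem vdil_apply (hij : i ≠ j) (l t₀ : ℚ) (w : Fin (0 + 1 + 2) → ℝ) (q : Fin (0 + 1 + 2)) :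
    vdil i j l t₀ w q = if q = yIdx 2 then w q else (t₀ : ℝ) + (w (yIdx 2) - l) * w q := by
  rcases idx_cases q with rfl | ⟨k, rfl⟩
  · rw [if_pos rfl]; exact yv_vdil l t₀ w
  · rw [if_neg (yIdx_ne_tIdx k).symm]
    rcases fin_two_eq_or hij k with rfl | rfl
    · exact tv_vdil_i hij l t₀ w
    · exact tv_vdil_j hij l t₀ w

/-- `vdil` is a `ℚ`-semialgebraic map on every `ℚ`-semialgebraic set. -/
theorem isSemialgebraicMapOn_vdil (hij : i ≠ j) (l t₀ : ℚ) {Q : Set (Fin (0 + 1 + 2) → ℝ)}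
    (hQ : IsSemialgebraic ℚ Q) : IsSemialgebraicMapOn ℚ Q (vdil i j l t₀) := by
  set P : Fin (0 + 1 + 2) → MvPolynomial (Fin (0 + 1 + 2)) ℚ := fun q =>
    if q = yIdx 2 then X q else MvPolynomial.C t₀ + (X (yIdx 2) - MvPolynomial.C l) * X q with hP
  refine (isSemialgebraicMapOn_aeval hQ P).congr fun w _ => ?_
  funext q
  rw [vdil_apply hij]
  by_cases hq : q = yIdx 2
  · rw [hP]; simp only [if_pos hq, MvPolynomial.aeval_X]
  · rw [hP]
    simp only [if_neg hq, map_add, map_mul, map_sub, MvPolynomial.aeval_C, MvPolynomial.aeval_X, eq_ratCast]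

/-- The derivative of `vdil`. -/
def vdilL (i j : Fin 2) (l t₀ : ℚ) (w : Fin (0 + 1 + 2) → ℝ) : (Fin (0 + 1 + 2) → ℝ) →L[ℝ] (Fin (0 + 1 + 2) → ℝ) :=
  (dilL j l (dil i l t₀ w)).comp (dilL i l w)

/-- `vdil` has the derivative `vdilL`. -/
theorem hasFDerivAt_vdil (l t₀ : ℚ) (w : Fin (0 + 1 + 2) → ℝ) :
    HasFDerivAt (vdil i j l t₀) (vdilL i j l t₀ w) w :=
  (hasFDerivAt_dil j l t₀ (dil i l t₀ w)).comp w (hasFDerivAt_dil i l t₀ w)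

/-- The Jacobian of `vdil` is `(y − l)²`. -/
theorem abs_det_vdilL (l t₀ : ℚ) (w : Fin (0 + 1 + 2) → ℝ) : |(vdilL i j l t₀ w).det| = (yv w - l) ^ 2 := by
  have key : (vdilL i j l t₀ w).det = (dilL j l (dil i l t₀ w)).det * (dilL i l w).det := by
    simp only [ContinuousLinearMap.det, vdilL]
    exact LinearMap.det_comp _ _
  rw [key, det_dilL, det_dilL, yv_dil, ← sq, abs_of_nonneg (sq_nonneg _)]

/-! ### The move -/

/-- **Both letters through the pinch vertex: the vertex dilation.** A datum of `HDiff₁` pinching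
at the left end with `cᵢ = t₀` and `cⱼ(l) = t₀` is good for `GG 0 2 2`: the vertex dilation
(rule 2) turns it into a common-slope datum (constant letters `0, λ`, constant bounds `A', B'`),
good by `RebaseDiff.good_any`. [Kontsevich–Zagier 2001, §1.2, rule (2)] -/
theorem IsDN.good_vtx_both (h : IsDN s l u A B T p a i j) (hL : LData T a i j ci cj)
    (hpinch : evq A l = evq B l) (hci : ci.2 = evq A l) (hcj : evq cj l = evq A l) : Good 2 (KZ.of s) := by
  have hij := h.ne
  -- constants
  set t₀ : ℚ := evq A l with ht₀
  set α : ℚ := A.1 (Fin.last 0) with hα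
  set β : ℚ := B.1 (Fin.last 0) with hβ
  set lam : ℚ := cj.1 (Fin.last 0) with hlamdef
  have hA : ∀ y : ℝ, ev A y = t₀ + α * (y - l) := fun y => by rw [ev_pinch A l]
  have hB : ∀ y : ℝ, ev B y = t₀ + β * (y - l) := fun y => by rw [ev_pinch B l, ← hpinch]
  have hC : ∀ y : ℝ, ev cj y = t₀ + lam * (y - l) := fun y => by rw [ev_pinch cj l, hcj]
  have hciv : ∀ y : ℝ, ev ci y = t₀ := fun y => by rw [ev_of_fst_eq_zero hL.ci0, hci]
  -- the new domain
  set Q := gDom 0 2 2 ![RebaseZero.mk 1 (-l), RebaseZero.mk (-1) u] (nlo i (RebaseZero.mk 0 α)) (nhi j (RebaseZero.mk 0 β))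
    with hQ
  have mQ : ∀ w, w ∈ Q ↔ ((l : ℝ) < yv w ∧ yv w < u) ∧ (α : ℝ) < tv w i ∧ tv w i < tv w j ∧ tv w j < β := fun w => by
    rw [hQ, mem_nDom_Ioo hij, ev_mk_zero, ev_mk_zero]
  set Ψ := vdil i j l t₀ with hΨ
  set Φ := vundil i j l t₀ with hΦ
  have hRD : ∀ w ∈ Q, Ψ w ∈ s.domain := fun w hw => by
    obtain ⟨⟨h1, h2⟩, h3, h4, h5⟩ := (mQ w).1 hw
    have hy : 0 < yv w - l := by linarith
    rw [h.mem, hΨ, yv_vdil, tv_vdil_i hij, tv_vdil_j hij, hA, hB]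
    exact ⟨⟨h1, h2⟩, by nlinarith, by nlinarith, by nlinarith⟩
  have hDR : ∀ z ∈ s.domain, Φ z ∈ Q := fun z hz => by
    obtain ⟨⟨h1, h2⟩, h3, h4, h5⟩ := (h.mem z).1 hz
    have hy : 0 < yv z - l := by linarith
    rw [hA] at h3
    rw [hB] at h5
    rw [mQ, hΦ, yv_vundil, tv_vundil_i hij, tv_vundil_j hij, lt_div_iff₀ hy, div_lt_div_iff_of_pos_right hy,
      div_lt_iff₀ hy]
    exact ⟨⟨h1, h2⟩, by linarith, by linarith, by linarith⟩
  have hyQ : ∀ w ∈ Q, yv w ≠ l := fun w hw => ne_of_gt ((mQ w).1 hw).1.1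
  have himg : Ψ '' Q = s.domain := by
    ext z
    constructor
    · rintro ⟨w, hw, rfl⟩
      exact hRD w hw
    · intro hz
      have hy : yv z ≠ l := ne_of_gt ((h.mem z).1 hz).1.1
      exact ⟨Φ z, hDR z hz, vdil_vundil l t₀ hy⟩
  have hsaQ : IsSemialgebraic ℚ Q := isSemialgebraic_gDom _ _ _ _
  -- the new literal datum
  set a' : Fin 2 → Option Cf := Function.update (Function.update a i (some (RebaseZero.mk 0 0))) j
    (some (RebaseZero.mk 0 lam)) with ha'
  have ha'j : a' j = some (RebaseZero.mk 0 lam) := by rw [ha', Function.update_self]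
  have ha'i : a' i = some (RebaseZero.mk 0 0) := by
    rw [ha', Function.update_of_ne hij, Function.update_self]
  set f' : (Fin (0 + 1 + 2) → ℝ) → ℝ := glitB T p a' with hf'
  have hf : ∀ w ∈ Q, f' w = s.integrand (Ψ w) * |(vdilL i j l t₀ w).det| := by
    intro w hw
    have hzD := hRD w hw
    obtain ⟨⟨h1, -⟩, -, -, -⟩ := (mQ w).1 hw
    have hy : yv w - l ≠ 0 := by linarith
    have eL : f' w = Kc T p * (1 / (yv w - T.ℓ₂.2)) * ((1 / (tv w i - 0)) * (1 / (tv w j - lam))) := by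
      rw [hf', glitB_two T p a' hij (RebaseZero.mk 0 0) (RebaseZero.mk 0 lam) ha'i ha'j hL.n1 hL.n2, ev_mk_zero,
        ev_mk_zero, Rat.cast_zero]
    have eR : s.integrand (Ψ w) * |(vdilL i j l t₀ w).det| =
        Kc T p * (1 / (yv w - T.ℓ₂.2)) * ((1 / ((yv w - l) * tv w i)) * (1 / ((yv w - l) * (tv w j - lam)))) *
          (yv w - l) ^ 2 := by
      rw [h.int hzD, abs_det_vdilL, glitB_two T p a hij ci cj hL.hi hL.hj hL.n1 hL.n2, hΨ, yv_vdil, tv_vdil_i hij,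
        tv_vdil_j hij, hciv, hC]
      congr 2; ring
    rw [eL, eR, sub_zero]
    by_cases hi0 : tv w i = 0
    · rw [hi0]; simp
    by_cases hj0 : tv w j - (lam : ℝ) = 0
    · rw [hj0]; simp
    field_simp
  -- rule (2)
  obtain ⟨r', hd', hi', hrel⟩ := cov_pull s hsaQ Ψ (fun w => vdilL i j l t₀ w) (isSemialgebraicMapOn_vdil hij l t₀ hsaQ)
    (fun w _ => (hasFDerivAt_vdil l t₀ w).hasFDerivWithinAt) (vdil_injOn l t₀ hyQ) himg f'
    (isSemialgebraicFunOn_glit hsaQ _ _ _ _ _ _ _ _) hf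
  have hbdQ : Bornology.IsBounded r'.domain := by rw [hd']; exact isBounded_nDom_Ioo hij l u _ _
  refine RebaseZero.good_of_sub_mem hrel (good_any r' _ T.L T.e p T.ℓ₁ T.ℓ₂ a' (nlo i (RebaseZero.mk 0 α))
    (nhi j (RebaseZero.mk 0 β)) hL.n1 hL.n2 ⟨0, fun k c hc => ?_⟩ hbdQ hd' fun w _ => by rw [hi', hf']; rfl)
  rcases fin_two_eq_or hij k with rfl | rfl
  · rw [ha'i] at hc; cases hc; rfl
  · rw [ha'j] at hc; cases hc; rfl

end RebaseE1

/-- **Registered brick `rebaseSimpleZero_E1vertexBoth`** (part `rebaseSimpleZero_HDiff1_of_HPar1` of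
`stub_rebaseSimpleZeroTwo`, line `janus-bands`): a datum of the interval normal form `HDiff₁`
(`RebaseE1.IsDN`) which pinches at the left end with BOTH letters through the pinch vertex is
congruent modulo `KZ.relations` to the subgroup generated by `GG 0 2 2`
(`RebaseE1.IsDN.good_vtx_both`: the vertex dilation `t = t₀ + (y − l) s` of both fibres, one
rational change of variables of Jacobian `(y − l)²`, makes both letters and both bounds constant;
the result is a common-slope datum, `RebaseDiff.good_any`). [Kontsevich–Zagier 2001, §1.2, rule (2)] -/
theorem rebaseSimpleZero_E1vertexBoth (i j : Fin 2) (s : KZ.IntegralRep (0 + 1 + 2)) (l u : ℚ) (A B ci cj : (Fin (0 + 1) → ℚ) × ℚ) (T : RebaseZero.BData) (p : MvPolynomial (Fin 0) ℚ) (a : Fin 2 → Option ((Fin (0 + 1) → ℚ) × ℚ)) (h : RebaseE1.IsDN s l u A B T p a i j) (hL : RebaseE1.LData T a i j ci cj) (hpinch : RebaseE1.evq A l = RebaseE1.evq B l) (hci : ci.2 = RebaseE1.evq A l) (hcj : RebaseE1.evq cj l = RebaseE1.evq A l) : RebaseZero.Good 2 (KZ.of s) :=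
  h.good_vtx_both hL hpinch hci hcj

end Summit.KontsevichZagierPeriods.ArrangementNormalForm.JanusBands
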